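import Literature.Analysis.FluidPDE.LpOseenDuhamel
import Literature.Analysis.FluidPDE.MildL3Restart
import Literature.Analysis.FluidPDE.HeatFlowLpClass
import Literature.Analysis.FluidPDE.KNSSSmoothingHolds
import Literature.Analysis.FluidPDE.ClassicalSolutionGlue
import HarnessLib

/-!
# Mild solutions in `L^∞_t L^p_x`, `3 < p < ∞`, have classical representatives (Kato's route)

Analysis/FluidPDE proofs file (theorems only: no definitions, no named facts) on the discharge
path of `Literature.Analysis.FluidPDE.chae2007_asymptoticallySelfSimilar_local` (D. Chae, Math. Ann.
338 (2007), Thm 1.5; the profile conclusion `V̄ = 0` for `3 < p < ∞`). Let `u` be jointly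
measurable on `(0, S) × ℝ³` with `‖u(τ)‖_{L^p} ≤ M`, weakly divergence-free slices, and the two-time
duality (mild) identity of Fabes–Jones–Rivière between all `0 < s ≤ t < S` (`ν = 1`). Then after
every time `s₀ ∈ (0, S)` there is an interval on which `u` agrees, slice by slice a.e., with a
classical solution of Navier–Stokes (`LpMildKato.exists_classical_representative`). The route is
Kato's (Math. Z. 187 (1984)) in the subcritical range, where everything is elementary:

* `LpMildKato.ae_eq_heatTest_sub_kochTataruBilinear` — **identification with the Oseen
  representative**: `u(t) = e^{tΔ}u(0) − B(u,u)(t)` a.e. (the duality identity at `t`, the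
  symmetry of the caloric pairing, the tested form of `B(u,u)(t)` of `LpOseenDuhamel.lean`, and the
  `L^p` annihilator lemma; Lemarié-Rieusset 2016, Thm. 6.1 with Prop. 6.5);
* `LpMildKato.exists_kato_representative` — **comparison with Kato's solution**: Kato's `L^p`
  fixed point `u_K` from the datum `u(0)` (`KatoLp.exists_katoLp_fixedPoint_heatTest`) agrees with
  `u` a.e. at every time of a short interval `(0, T₁)`, by the contraction estimate in the weighted
  norm `sup τ^{(1−3/p)/2}‖·‖_p` (Kato 1984, §2: uniqueness inside his class, here with one factor
  only in `L^∞_t L^p_x`, which the Beta integrals allow for `p > 3`);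
* `LpMildKato.exists_classical_representative` — **smoothing**: restart at `T₁/2`, where `u_K` is
  bounded, the integral equation from the (essentially bounded) slice (identification again), the
  smoothing of bounded solutions of the integral equation (`knss2009_smoothing_holds`, KNSS 2009
  Prop. 4.1) and the classical equations for smooth mild solutions
  (`classical_of_smooth_isMildNSSolutionOn_holds`, Fabes–Jones–Rivière 1972, Thm. 2.1).

## References

* T. Kato, Math. Z. 187 (1984) 471–480, Thm. 1 and §2. [Kato1984]
* E. B. Fabes, B. F. Jones, N. M. Rivière, Arch. Rational Mech. Anal. 45 (1972), Thm. 2.1.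
  [FabesJonesRiviere1972]
* P. G. Lemarié-Rieusset, *The Navier–Stokes Problem in the 21st Century* (2016), Thm. 6.1,
  Prop. 6.5, Thm. 7.5. [LemarieRieusset2016]
* G. Koch, N. Nadirashvili, G. Seregin, V. Šverák, Acta Math. 203 (2009), Prop. 4.1.
  [KochNadirashviliSereginSverak2009]
-/

noncomputable section

open MeasureTheory TopologicalSpace Set Function Filter Topology InnerProductSpace Metric
open scoped RealInnerProductSpace ENNReal NNReal

namespace Literature.Analysis.FluidPDE

namespace LpMildKato

open LpOseen

/-- Local notation for physical space `ℝ³ = EuclideanSpace ℝ (Fin 3)`. -/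
local notation "ℝ³" => EuclideanSpace ℝ (Fin 3)

/-! ### From uniform to Kato-weighted `L^p` bounds -/

section Weights

variable {p : ℝ≥0∞}

/-- **A uniform `L^p` bound is a Kato-weighted bound on a finite interval**: if `‖f‖_p ≤ M` then
`‖f‖_p ≤ (M t^w) τ^{-w}` for `0 < τ < t`, `0 ≤ w`. [folklore] -/
theorem eLpNorm_le_weighted {f : ℝ³ → ℝ³} {M : ℝ≥0} (hM : eLpNorm f p volume ≤ M) {t τ w : ℝ}
    (hτ : τ ∈ Ioo 0 t) (hw : 0 ≤ w) :
    eLpNorm f p volume ≤ ENNReal.ofReal ((M : ℝ) * t ^ w * τ ^ (-w)) := by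
  have ht : 0 < t := hτ.1.trans hτ.2
  refine hM.trans ?_
  rw [← ENNReal.ofReal_coe_nnreal]
  refine ENNReal.ofReal_le_ofReal ?_
  have h1 : t ^ (-w) ≤ τ ^ (-w) :=
    Real.rpow_le_rpow_of_nonpos hτ.1 hτ.2.le (neg_nonpos.2 hw)
  have h2 : t ^ w * t ^ (-w) = 1 := by
    rw [← Real.rpow_add ht, add_neg_cancel, Real.rpow_zero]
  calc (M : ℝ) = M * (t ^ w * t ^ (-w)) := by rw [h2, mul_one]
    _ ≤ M * (t ^ w * τ ^ (-w)) := by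
        refine mul_le_mul_of_nonneg_left (mul_le_mul_of_nonneg_left h1 ?_) (NNReal.coe_nonneg M)
        exact Real.rpow_nonneg ht.le _
    _ = M * t ^ w * τ ^ (-w) := by ring

/-- Kato's weight exponent `w = (1 − 3/p)/2` is nonnegative for `p > 3`. [cite: Kato1984, (2.1)] -/
theorem weight_nonneg (hp₃ : 3 < p) (hp : p < ∞) : 0 ≤ (1 - 3 / p.toReal) / 2 := by
  have hr3 := KatoLp.three_lt_toReal hp₃ hp
  have : 3 / p.toReal < 1 := by rw [div_lt_one (by linarith)]; exact hr3
  linarith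

/-- Kato's weight exponent `w = (1 − 3/p)/2` is positive for `p > 3`. [cite: Kato1984, (2.1)] -/
theorem weight_pos (hp₃ : 3 < p) (hp : p < ∞) : 0 < (1 - 3 / p.toReal) / 2 := by
  have hr3 := KatoLp.three_lt_toReal hp₃ hp
  have : 3 / p.toReal < 1 := by rw [div_lt_one (by linarith)]; exact hr3
  linarith

/-- Kato's weight exponent is `< 1/2`. [cite: Kato1984, (2.1)] -/
theorem weight_lt_half (hp₃ : 3 < p) (hp : p < ∞) : (1 - 3 / p.toReal) / 2 < 1 / 2 := by
  have hr3 := KatoLp.three_lt_toReal hp₃ hp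
  have : 0 < 3 / p.toReal := by positivity
  linarith

end Weights

/-! ### Identification with the Oseen representative -/

section Identification

variable {p : ℝ≥0∞} {u : ℝ → ℝ³ → ℝ³} {T : ℝ} {M : ℝ≥0}

/-- The sum of weakly divergence-free `Lᵖ` fields is weakly divergence free (linearity of the
weak identity; local copy of the tree's `IsWeaklyDivFree.add_of_memLp'`). [folklore] -/
theorem isWeaklyDivFree_add {q : ℝ≥0∞} (hq : 1 ≤ q) {a b : ℝ³ → ℝ³} (ha : IsWeaklyDivFree a)
    (hb : IsWeaklyDivFree b) (ham : MemLp a q volume) (hbm : MemLp b q volume) :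
    IsWeaklyDivFree (a + b) := by
  intro θ hθ
  have hgc : Continuous (gradient θ) :=
    (InnerProductSpace.toDual ℝ ℝ³).symm.continuous.comp (hθ.contDiff.continuous_fderiv (by simp))
  have hgs : HasCompactSupport (gradient θ) :=
    (hθ.hasCompactSupport.fderiv (𝕜 := ℝ)).comp_left (g := (InnerProductSpace.toDual ℝ ℝ³).symm)
      (map_zero _)
  have ia := integrable_inner_of_locallyIntegrable_of_hasCompactSupport
    (ham.locallyIntegrable hq) hgc hgs
  have ib := integrable_inner_of_locallyIntegrable_of_hasCompactSupport
    (hbm.locallyIntegrable hq) hgc hgs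
  simp only [Pi.add_apply, inner_add_left]
  rw [integral_add ia ib, ha θ hθ, hb θ hθ, add_zero]

/-- **Identification of an `L^∞_t L^p_x` mild solution with its Oseen representative**
(Lemarié-Rieusset 2016, Thm. 6.1 with Prop. 6.5: very weak solutions are Oseen solutions; here for
`3 < p < ∞`, unit viscosity). Let `u` be jointly measurable with `u(0) ∈ L^p` weakly divergence
free, `‖u(τ)‖_{L^p} ≤ M` on `(0, T)`, and let `t ∈ (0, T)` be a time at which `u(t)` is weakly
divergence free and the duality identity from the datum holds (`IsMildNSSolutionFrom 1 0 (u 0) u t`).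
Then `u(t) = e^{tΔ}u(0) − B(u,u)(t)` almost everywhere (`B = kochTataruBilinear`). [cite: LemarieRieusset2016, Thm. 6.1 / Prop. 6.5] -/
theorem ae_eq_heatTest_sub_kochTataruBilinear (hp₃ : 3 < p) (hp : p < ∞)
    (hum : Measurable (uncurry u)) (hu0 : MemLp (u 0) p volume) (hdiv0 : IsWeaklyDivFree (u 0))
    (huM : ∀ τ ∈ Ioo 0 T, eLpNorm (u τ) p volume ≤ M) {t : ℝ} (ht : t ∈ Ioo 0 T)
    (hdivt : IsWeaklyDivFree (u t)) (hmild : IsMildNSSolutionFrom 1 0 (u 0) u t) :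
    u t =ᵐ[volume] fun x => heatTest 1 (u 0) t x - kochTataruBilinear u u t x := by
  have hp1 : 1 < p := lt_trans (by norm_num) hp₃
  have h1p : 1 ≤ p := hp1.le
  haveI hconj := holderConjugate_self hp1
  set q : ℝ≥0∞ := (1 - p⁻¹)⁻¹ with hq
  set w : ℝ := (1 - 3 / p.toReal) / 2 with hw
  have hw0 : 0 ≤ w := weight_nonneg hp₃ hp
  -- the weighted bound of `u` on `(0, t)`
  set Ku : ℝ := (M : ℝ) * t ^ w with hKu
  have hKu0 : 0 ≤ Ku := mul_nonneg (NNReal.coe_nonneg M) (Real.rpow_nonneg ht.1.le _)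
  have hub : ∀ τ ∈ Ioo 0 t, eLpNorm (u τ) p volume ≤ ENNReal.ofReal (Ku * τ ^ (-w)) := fun τ hτ =>
    eLpNorm_le_weighted (huM τ ⟨hτ.1, hτ.2.trans ht.2⟩) hτ hw0
  have hutp : MemLp (u t) p volume :=
    ⟨(measurable_slice hum t).aestronglyMeasurable, lt_of_le_of_lt (huM t ht) ENNReal.coe_lt_top⟩
  -- the free term
  set g : ℝ³ → ℝ³ := heatTest 1 (u 0) t with hgdef
  have hgt : g = fun x => UnboundedOperators.heatExtension (u 0) t x := by
    rw [hgdef, heatTest_of_pos one_pos ht.1, one_mul]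
  have hgp : MemLp g p volume := by
    rw [hgt]; exact UnboundedOperators.memLp_heatExtension_holds hu0 h1p ht.1
  have hdivg : IsWeaklyDivFree g := by
    rw [hgt]; exact hdiv0.heatExtension_of_memLp h1p hu0 ht.1
  -- the Duhamel term
  obtain ⟨c, hc, hBmem⟩ := LpOseen.exists_memLp_kochTataruBilinear (p := p) hp₃ hp
  set B : ℝ³ → ℝ³ := kochTataruBilinear u u t with hB
  have hBp : MemLp B p volume := (hBmem hum hum hKu0 hKu0 ht.1 hub hub).1
  have hdivB : IsWeaklyDivFree B :=
    LpOseen.isWeaklyDivFree_kochTataruBilinear hp₃ hp hum hum hKu0 hKu0 ht.1 hub hub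
  -- the difference `D = (u t - g) + B`
  set D : ℝ³ → ℝ³ := (u t - g) + B with hD
  have hDp : MemLp D p volume := (hutp.sub hgp).add hBp
  have hdivD : IsWeaklyDivFree D :=
    isWeaklyDivFree_add h1p (hdivt.sub h1p hdivg hutp hgp) hdivB (hutp.sub hgp) hBp
  -- orthogonality to solenoidal tests
  have horth : ∀ φ : ℝ³ → ℝ³, FunctionSpaces.IsTestFunctionOn (⊤ : Opens ℝ³) φ →
      VectorCalculus.IsDivFree φ → ∫ x, ⟪D x, φ x⟫ = 0 := by
    intro φ hφ hφdiv
    have hφc : Continuous φ := hφ.contDiff.continuous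
    have hφcs : HasCompactSupport φ := hφ.hasCompactSupport
    have hφq : ∀ r : ℝ≥0∞, MemLp φ r volume := fun r => hφc.memLp_of_hasCompactSupport hφcs
    have iut : Integrable fun x => ⟪u t x, φ x⟫ :=
      integrable_inner_of_locallyIntegrable_of_hasCompactSupport (hutp.locallyIntegrable h1p) hφc hφcs
    have ig : Integrable fun x => ⟪g x, φ x⟫ :=
      integrable_inner_of_locallyIntegrable_of_hasCompactSupport (hgp.locallyIntegrable h1p) hφc hφcs
    have iB : Integrable fun x => ⟪B x, φ x⟫ :=
      integrable_inner_of_locallyIntegrable_of_hasCompactSupport (hBp.locallyIntegrable h1p) hφc hφcs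
    have hsplit : ∫ x, ⟪D x, φ x⟫ = (∫ x, ⟪u t x, φ x⟫) - (∫ x, ⟪g x, φ x⟫) + ∫ x, ⟪B x, φ x⟫ := by
      rw [hD]
      simp only [Pi.add_apply, Pi.sub_apply, inner_add_left, inner_sub_left]
      calc ∫ x, ⟪u t x, φ x⟫ - ⟪g x, φ x⟫ + ⟪B x, φ x⟫
          = (∫ x, ⟪u t x, φ x⟫ - ⟪g x, φ x⟫) + ∫ x, ⟪B x, φ x⟫ := integral_add (iut.sub ig) iB
        _ = _ := by rw [integral_sub iut ig]
    -- (1) the duality identity at `t`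
    have h1 : ∫ x, ⟪u t x, φ x⟫ = (∫ x, ⟪u 0 x, heatTest 1 φ t x⟫) +
        ∫ τ in (0 : ℝ)..t, ∫ x, ⟪u τ x, convect (u τ) (heatTest 1 φ (t - τ)) x⟫ := by
      simpa using hmild φ hφ hφdiv
    -- (2) the free term: symmetry of the heat semigroup
    have h2 : ∫ x, ⟪g x, φ x⟫ = ∫ x, ⟪u 0 x, heatTest 1 φ t x⟫ := by
      rw [heatTest_of_pos one_pos ht.1 φ, one_mul, hgt]
      exact (integral_inner_heatExtension_comm (p := p) (q := q) hu0 (hφq _) ht.1).symm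
    -- (3) the Duhamel term in tested form
    have h3 : ∫ x, ⟪B x, φ x⟫ = -∫ τ in (0 : ℝ)..t, ∫ x, ⟪u τ x, convect (u τ) (heatTest 1 φ (t - τ)) x⟫ :=
      LpOseen.integral_inner_kochTataruBilinear_eq_neg_intervalIntegral hp₃ hp hum hKu0 ht.1 hub hφ hφdiv
    rw [hsplit, h1, h2, h3]
    ring
  -- the annihilator lemma in `L^p`
  have hzero := IsWeaklyDivFree.ae_eq_zero_of_memLp_of_forall_integral_inner_eq_zero hp1 hp hDp
    hdivD horth
  filter_upwards [hzero] with x hx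
  have hx' : (u t x - g x) + B x = 0 := hx
  rw [add_eq_zero_iff_eq_neg, sub_eq_iff_eq_add] at hx'
  rw [hx']
  abel

end Identification

/-! ### Comparison with Kato's solution -/

section Kato

variable {p : ℝ≥0∞} {u : ℝ → ℝ³ → ℝ³} {T : ℝ} {M : ℝ≥0}

/-- **Pointwise size of the free evolution of an `L^p` datum in Kato's form**: for `a ∈ L^p(ℝ³)`,
`1 < p < ∞`, `0 < t < T₁`, `‖e^{tΔ}a(x)‖ ≤ (4π)^{-3/(2p)} ‖a‖_p T₁^{(1−3/p)/2} t^{-1/2}` at every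
`x` (Hölder, `UnboundedOperators.enorm_heatExtension_le`: `‖e^{tΔ}a‖_∞ ≤ (4πt)^{-3/(2p)}‖a‖_p`, and
`t^{-3/(2p)} = t^{w} t^{-1/2} ≤ T₁^{w} t^{-1/2}`). [cite: Kato1984, (2.3')] -/
theorem norm_heatTest_le_rpow_neg_half (hp₃ : 3 < p) (hp : p < ∞) {a : ℝ³ → ℝ³}
    (ha : MemLp a p volume) {T₁ t : ℝ} (ht : t ∈ Ioo 0 T₁) (x : ℝ³) :
    ‖heatTest 1 a t x‖ ≤ (4 * Real.pi) ^ (-(3 / (2 * p.toReal))) * (eLpNorm a p volume).toReal *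
      T₁ ^ ((1 - 3 / p.toReal) / 2) * t ^ (-(1 / 2 : ℝ)) := by
  have hp1 : 1 < p := lt_trans (by norm_num) hp₃
  have hr3 := KatoLp.three_lt_toReal hp₃ hp
  set r : ℝ := p.toReal with hr
  have hr0 : 0 < r := by linarith
  set w : ℝ := (1 - 3 / r) / 2 with hw
  have hw0 : 0 ≤ w := weight_nonneg hp₃ hp
  have ht0 : 0 < t := ht.1
  rw [heatTest_of_pos one_pos ht0, one_mul]
  have h := UnboundedOperators.enorm_heatExtension_le ha hp1.le ht0 x
  rw [finrank_R3_real] at h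
  -- the constant in real form
  have hbase : 0 ≤ (4 * Real.pi * t) ^ (-(3 : ℝ) / 2) := Real.rpow_nonneg (by positivity) _
  have hpi : p⁻¹.toReal = 1 / r := by rw [ENNReal.toReal_inv, one_div]
  have e1 : ENNReal.ofReal ((4 * Real.pi * t) ^ (-(3 : ℝ) / 2)) ^ p⁻¹.toReal =
      ENNReal.ofReal ((4 * Real.pi) ^ (-(3 / (2 * r))) * t ^ (-(3 / (2 * r)))) := by
    rw [hpi, ENNReal.ofReal_rpow_of_nonneg hbase (by positivity), ← Real.rpow_mul (by positivity),
      Real.mul_rpow (by positivity) ht0.le]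
    congr 2 <;> · field_simp
  rw [e1] at h
  have hfin : ENNReal.ofReal ((4 * Real.pi) ^ (-(3 / (2 * r))) * t ^ (-(3 / (2 * r)))) *
      eLpNorm a p volume ≠ ⊤ := ENNReal.mul_ne_top ENNReal.ofReal_ne_top ha.2.ne
  have hreal : ‖UnboundedOperators.heatExtension a t x‖ ≤
      ((4 * Real.pi) ^ (-(3 / (2 * r))) * t ^ (-(3 / (2 * r)))) * (eLpNorm a p volume).toReal := by
    have := ENNReal.toReal_mono hfin h
    rwa [toReal_enorm, ENNReal.toReal_mul, ENNReal.toReal_ofReal (by positivity)] at this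
  refine hreal.trans ?_
  -- `t^{-3/(2r)} = t^{w} t^{-1/2} ≤ T₁^{w} t^{-1/2}`
  have e2 : t ^ (-(3 / (2 * r))) = t ^ w * t ^ (-(1 / 2 : ℝ)) := by
    rw [← Real.rpow_add ht0]; congr 1; rw [hw]; field_simp; ring
  have hle : t ^ w ≤ T₁ ^ w := Real.rpow_le_rpow ht0.le ht.2.le hw0
  rw [e2]
  have h4 : 0 ≤ (4 * Real.pi) ^ (-(3 / (2 * r))) := Real.rpow_nonneg (by positivity) _
  have hN : 0 ≤ (eLpNorm a p volume).toReal := ENNReal.toReal_nonneg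
  have htm : 0 ≤ t ^ (-(1 / 2 : ℝ)) := Real.rpow_nonneg ht0.le _
  calc (4 * Real.pi) ^ (-(3 / (2 * r))) * (t ^ w * t ^ (-(1 / 2 : ℝ))) * (eLpNorm a p volume).toReal
      ≤ (4 * Real.pi) ^ (-(3 / (2 * r))) * (T₁ ^ w * t ^ (-(1 / 2 : ℝ))) * (eLpNorm a p volume).toReal := by
        gcongr
    _ = _ := by ring

/-- **Bilinearity of the Duhamel term at a point of absolute convergence**: if the slices of the
four pairs are integrable at `(τ, x)` for `τ ∈ (0, t)` and their time integrals at `x` converge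
absolutely, then `B(u,u)(t,x) − B(v,v)(t,x) = B(u, u−v)(t,x) + B(u−v, v)(t,x)`. [folklore] -/
theorem kochTataruBilinear_sub_eq {u v : ℝ → ℝ³ → ℝ³} {t : ℝ} {x : ℝ³}
    (hi : ∀ a b : ℝ → ℝ³ → ℝ³, (a = u ∨ a = v ∨ a = u - v) → (b = u ∨ b = v ∨ b = u - v) →
      ∀ τ ∈ Ioo 0 t, Integrable (fun y => oseenKernel (t - τ) (x - y) (a τ y) (b τ y)) volume)
    (hIuu : IntegrableOn (fun τ => ∫ y, oseenKernel (t - τ) (x - y) (u τ y) (u τ y)) (Ioo 0 t) volume)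
    (hIvv : IntegrableOn (fun τ => ∫ y, oseenKernel (t - τ) (x - y) (v τ y) (v τ y)) (Ioo 0 t) volume)
    (hIud : IntegrableOn (fun τ => ∫ y, oseenKernel (t - τ) (x - y) (u τ y) ((u - v) τ y)) (Ioo 0 t)
      volume)
    (hIdv : IntegrableOn (fun τ => ∫ y, oseenKernel (t - τ) (x - y) ((u - v) τ y) (v τ y)) (Ioo 0 t)
      volume) :
    kochTataruBilinear u u t x - kochTataruBilinear v v t x =
      kochTataruBilinear u (u - v) t x + kochTataruBilinear (u - v) v t x := by
  unfold kochTataruBilinear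
  rw [← integral_sub hIuu hIvv, ← integral_add hIud hIdv]
  refine setIntegral_congr_fun measurableSet_Ioo fun τ hτ => ?_
  have i1 := hi u u (Or.inl rfl) (Or.inl rfl) τ hτ
  have i2 := hi v v (Or.inr (Or.inl rfl)) (Or.inr (Or.inl rfl)) τ hτ
  have i3 := hi u (u - v) (Or.inl rfl) (Or.inr (Or.inr rfl)) τ hτ
  have i4 := hi (u - v) v (Or.inr (Or.inr rfl)) (Or.inr (Or.inl rfl)) τ hτ
  rw [← integral_sub i1 i2, ← integral_add i3 i4]
  refine integral_congr_ae (Eventually.of_forall fun y => ?_)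
  simp only [Pi.sub_apply, oseenKernel_sub_right, oseenKernel_sub_left]
  abel

set_option maxHeartbeats 1600000 in
/-- **Comparison with Kato's solution, with constants depending only on `p` and the `L^p` bound**
(Kato 1984, Thm. 1 and §2, uniqueness inside the class `t^{(1−3/p)/2}L^p`, here with one factor
only in `L^∞_t L^p_x`). For `3 < p < ∞` and `M ≥ 0` there are a time `κ > 0` and a constant `C_b`
such that: whenever `u` is jointly measurable on `(0, T) × ℝ³` with a strongly measurable datum
`u(0) ∈ L^p`, `‖u(0)‖_{L^p} ≤ M`, weakly divergence free, `‖u(τ)‖_{L^p} ≤ M`, weakly divergence-free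
slices and the duality identity from the datum at every `t ∈ (0, T)` (`ν = 1`), then on
`(0, min(T, κ))` the slices `u(t)` agree a.e. with Kato's solution `u_K` from `u(0)`, a jointly
measurable field with `|u_K(t, x)| ≤ C_b t^{-1/2}`. Proof: `u(t) = e^{tΔ}u(0) − B(u,u)(t)` a.e.
(`ae_eq_heatTest_sub_kochTataruBilinear`), `u_K` solves the same equation pointwise, and
`d = u − u_K` satisfies `d(t) = −B(u,d)(t) − B(d,u_K)(t)` a.e., whence
`sup τ^w‖d(τ)‖_p ≤ ½ sup τ^w‖d(τ)‖_p` by Kato's estimate, `κ` being chosen from `M` alone. [cite: Kato1984, Thm. 1 and §2] -/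
theorem exists_kato_time (hp₃ : 3 < p) (hp : p < ∞) (M : ℝ≥0) :
    ∃ κ : ℝ, 0 < κ ∧ ∃ Cb : ℝ, 0 ≤ Cb ∧ ∀ ⦃u : ℝ → ℝ³ → ℝ³⦄ ⦃T : ℝ⦄,
      Measurable (uncurry u) → StronglyMeasurable (u 0) → MemLp (u 0) p volume →
      eLpNorm (u 0) p volume ≤ M → IsWeaklyDivFree (u 0) → 0 < T →
      (∀ τ ∈ Ioo 0 T, eLpNorm (u τ) p volume ≤ M) →
      (∀ t ∈ Ioo 0 T, IsWeaklyDivFree (u t)) →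
      (∀ t ∈ Ioo 0 T, IsMildNSSolutionFrom 1 0 (u 0) u t) →
      ∃ uK : ℝ → ℝ³ → ℝ³, Measurable (uncurry uK) ∧
        (∀ t ∈ Ioo 0 (min T κ), ∀ x, ‖uK t x‖ ≤ Cb * t ^ (-(1 / 2 : ℝ))) ∧
        ∀ t ∈ Ioo 0 (min T κ), u t =ᵐ[volume] uK t := by
  have hp1 : 1 < p := lt_trans (by norm_num) hp₃
  have h1p : 1 ≤ p := hp1.le
  have hp0 : p ≠ 0 := (zero_lt_one.trans hp1).ne'
  have hr3 := KatoLp.three_lt_toReal hp₃ hp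
  set w : ℝ := (1 - 3 / p.toReal) / 2 with hw
  have hw0 : 0 < w := weight_pos hp₃ hp
  -- ### constants
  obtain ⟨cK, hcK, HK⟩ :=
    KatoLp.exists_katoLp_fixedPoint_heatTest (E := ℝ³) finrank_euclideanSpace_fin hp₃ hp
  obtain ⟨cB, hcB, HB⟩ := LpOseen.exists_memLp_kochTataruBilinear (p := p) hp₃ hp
  set L : ℝ := cK * ((M : ℝ) + 1) + 2 * cB * ((M : ℝ) + 2 * ((M : ℝ) + 1)) + 1 with hL
  have hL0 : 0 < L := by positivity
  set ε₀ : ℝ := 1 / L with hε₀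
  have hε₀0 : 0 < ε₀ := by positivity
  have hKε : cK * ((M : ℝ) + 1) * ε₀ ≤ 1 := by
    rw [hε₀, ← mul_div_assoc, mul_one, div_le_one hL0, hL]
    nlinarith [mul_nonneg hcB (by positivity : (0 : ℝ) ≤ (M : ℝ) + 2 * ((M : ℝ) + 1))]
  have hBε : cB * ((M : ℝ) + 2 * ((M : ℝ) + 1)) * ε₀ ≤ 1 / 2 := by
    rw [hε₀, ← mul_div_assoc, mul_one, div_le_iff₀ hL0, hL]
    nlinarith [mul_nonneg hcK.le (by positivity : (0 : ℝ) ≤ (M : ℝ) + 1),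
      mul_nonneg hcB (by positivity : (0 : ℝ) ≤ (M : ℝ) + 2 * ((M : ℝ) + 1))]
  set κ : ℝ := ε₀ ^ (1 / w) with hκ
  have hκ0 : 0 < κ := Real.rpow_pos_of_pos hε₀0 _
  have hκw : κ ^ w = ε₀ := by
    rw [hκ, ← Real.rpow_mul hε₀0.le, one_div, inv_mul_cancel₀ hw0.ne', Real.rpow_one]
  set c₄ : ℝ := (4 * Real.pi) ^ (-(3 / (2 * p.toReal))) with hc₄
  have hc₄0 : 0 ≤ c₄ := Real.rpow_nonneg (by positivity) _
  set Cb : ℝ := 2 * (((M : ℝ) + 1) + c₄ * (M : ℝ)) * κ ^ w with hCb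
  have hCb0 : 0 ≤ Cb := by positivity
  refine ⟨κ, hκ0, Cb, hCb0, ?_⟩
  intro u T hum hu0 hu0p hu0M hdiv0 hT huM hdiv hmild
  -- ### the interval
  set T₁ : ℝ := min T κ with hT₁
  have hT₁0 : 0 < T₁ := lt_min hT hκ0
  have hT₁T : T₁ ≤ T := min_le_left _ _
  have hT₁κ : T₁ ≤ κ := min_le_right _ _
  have hT₁wκ : T₁ ^ w ≤ κ ^ w := Real.rpow_le_rpow hT₁0.le hT₁κ hw0.le
  have hT₁w : T₁ ^ w ≤ ε₀ := hT₁wκ.trans_eq hκw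
  have hT₁w0 : 0 < T₁ ^ w := Real.rpow_pos_of_pos hT₁0 _
  -- ### Kato's solution from `u 0`
  set a : ℝ := ((M : ℝ) + 1) * T₁ ^ w with ha
  have ha0 : 0 < a := by positivity
  have hca : cK * a ≤ 1 := by
    calc cK * a = cK * ((M : ℝ) + 1) * T₁ ^ w := by rw [ha]; ring
      _ ≤ cK * ((M : ℝ) + 1) * ε₀ := mul_le_mul_of_nonneg_left hT₁w (by positivity)
      _ ≤ 1 := hKε
  set b : ℝ := c₄ * (M : ℝ) * T₁ ^ w with hb
  have hb0 : 0 ≤ b := by positivity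
  have hu0real : (eLpNorm (u 0) p volume).toReal ≤ (M : ℝ) := by
    have h := (ENNReal.toReal_le_toReal hu0p.2.ne ENNReal.coe_ne_top).2 hu0M
    rwa [ENNReal.coe_toReal] at h
  have hU : ∀ t ∈ Ioo 0 T₁, eLpNorm (heatTest 1 (u 0) t) p volume ≤ ENNReal.ofReal (a * t ^ (-w)) := by
    intro t ht
    have h1 : eLpNorm (heatTest 1 (u 0) t) p volume ≤ M :=
      (eLpNorm_heatFlow_le_of_memLp hu0p h1p _).trans hu0M
    refine (eLpNorm_le_weighted h1 ht hw0.le).trans (ENNReal.ofReal_le_ofReal ?_)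
    rw [ha]
    have : 0 ≤ T₁ ^ w * t ^ (-w) := mul_nonneg hT₁w0.le (Real.rpow_nonneg ht.1.le _)
    nlinarith
  have hUi : ∀ t ∈ Ioo 0 T₁, ∀ x, ‖heatTest 1 (u 0) t x‖ ≤ b * t ^ (-(1 / 2 : ℝ)) := by
    intro t ht x
    have h := norm_heatTest_le_rpow_neg_half hp₃ hp hu0p ht x
    refine h.trans ?_
    rw [hb, hc₄]
    have htm : 0 ≤ t ^ (-(1 / 2 : ℝ)) := Real.rpow_nonneg ht.1.le _
    have h4 : 0 ≤ (4 * Real.pi) ^ (-(3 / (2 * p.toReal))) := Real.rpow_nonneg (by positivity) _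
    have := mul_le_mul_of_nonneg_left hu0real h4
    have h2 : 0 ≤ T₁ ^ ((1 - 3 / p.toReal) / 2) * t ^ (-(1 / 2 : ℝ)) :=
      mul_nonneg (Real.rpow_nonneg hT₁0.le _) htm
    calc (4 * Real.pi) ^ (-(3 / (2 * p.toReal))) * (eLpNorm (u 0) p volume).toReal *
          T₁ ^ ((1 - 3 / p.toReal) / 2) * t ^ (-(1 / 2 : ℝ))
        = ((4 * Real.pi) ^ (-(3 / (2 * p.toReal))) * (eLpNorm (u 0) p volume).toReal) *
            (T₁ ^ ((1 - 3 / p.toReal) / 2) * t ^ (-(1 / 2 : ℝ))) := by ring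
      _ ≤ ((4 * Real.pi) ^ (-(3 / (2 * p.toReal))) * (M : ℝ)) *
            (T₁ ^ ((1 - 3 / p.toReal) / 2) * t ^ (-(1 / 2 : ℝ))) :=
          mul_le_mul_of_nonneg_right this h2
      _ = (4 * Real.pi) ^ (-(3 / (2 * p.toReal))) * (M : ℝ) * T₁ ^ w * t ^ (-(1 / 2 : ℝ)) := by
          rw [hw]; ring
  obtain ⟨uK, hKm, hfix, hKp, hKi, -⟩ := HK hu0 hT₁0 ha0 hb0 hca hU hUi
  -- ### weighted bounds on `(0, T₁)`
  have huw : ∀ τ ∈ Ioo 0 T₁, eLpNorm (u τ) p volume ≤ ENNReal.ofReal ((M : ℝ) * T₁ ^ w * τ ^ (-w)) :=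
    fun τ hτ => eLpNorm_le_weighted (huM τ ⟨hτ.1, hτ.2.trans_le hT₁T⟩) hτ hw0.le
  have hKw : ∀ τ ∈ Ioo 0 T₁, eLpNorm (uK τ) p volume ≤ ENNReal.ofReal (2 * a * τ ^ (-w)) := hKp
  have hMT : 0 ≤ (M : ℝ) * T₁ ^ w := by positivity
  have h2a : 0 ≤ 2 * a := by positivity
  -- the identification for `u`
  have hident : ∀ t ∈ Ioo 0 T₁, u t =ᵐ[volume] fun x => heatTest 1 (u 0) t x - kochTataruBilinear u u t x :=
    fun t ht => ae_eq_heatTest_sub_kochTataruBilinear hp₃ hp hum hu0p hdiv0 huM ⟨ht.1, ht.2.trans_le hT₁T⟩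
      (hdiv t ⟨ht.1, ht.2.trans_le hT₁T⟩) (hmild t ⟨ht.1, ht.2.trans_le hT₁T⟩)
  -- ### the contraction
  set d : ℝ → ℝ³ → ℝ³ := u - uK with hd
  have hdm : Measurable (uncurry d) := by
    have : uncurry d = uncurry u - uncurry uK := by funext q; rfl
    rw [this]; exact hum.sub hKm
  have hdslice : ∀ τ, d τ = u τ - uK τ := fun τ => rfl
  set Kw : ℝ := (M : ℝ) * T₁ ^ w + 2 * a with hKwdef
  have hKw0 : 0 ≤ Kw := by positivity
  have step : ∀ {N : ℝ}, 0 ≤ N →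
      (∀ τ ∈ Ioo 0 T₁, eLpNorm (d τ) p volume ≤ ENNReal.ofReal (N * τ ^ (-w))) →
      ∀ t ∈ Ioo 0 T₁, eLpNorm (d t) p volume ≤ ENNReal.ofReal ((1 / 2 * N) * t ^ (-w)) := by
    intro N hN hdN t ht
    have ht0 : 0 < t := ht.1
    -- weighted bounds on `(0, t)`
    have huw' : ∀ τ ∈ Ioo 0 t, eLpNorm (u τ) p volume ≤ ENNReal.ofReal ((M : ℝ) * T₁ ^ w * τ ^ (-w)) :=
      fun τ hτ => huw τ ⟨hτ.1, hτ.2.trans ht.2⟩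
    have hKw' : ∀ τ ∈ Ioo 0 t, eLpNorm (uK τ) p volume ≤ ENNReal.ofReal (2 * a * τ ^ (-w)) :=
      fun τ hτ => hKw τ ⟨hτ.1, hτ.2.trans ht.2⟩
    have hdw' : ∀ τ ∈ Ioo 0 t, eLpNorm (d τ) p volume ≤ ENNReal.ofReal (N * τ ^ (-w)) :=
      fun τ hτ => hdN τ ⟨hτ.1, hτ.2.trans ht.2⟩
    -- a.e. absolute convergence of the four Duhamel terms at `t`
    have A1 := LpOseen.ae_integrableOn_slices (p := p) hp₃ hp hum hum hMT hMT ht0 huw' huw'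
    have A2 := LpOseen.ae_integrableOn_slices (p := p) hp₃ hp hKm hKm h2a h2a ht0 hKw' hKw'
    have A3 := LpOseen.ae_integrableOn_slices (p := p) hp₃ hp hum hdm hMT hN ht0 huw' hdw'
    have A4 := LpOseen.ae_integrableOn_slices (p := p) hp₃ hp hdm hKm hN h2a ht0 hdw' hKw'
    -- the slices of all pairs are integrable at every point
    have hmem : ∀ a' : ℝ → ℝ³ → ℝ³, (a' = u ∨ a' = uK ∨ a' = u - uK) →
        ∀ τ ∈ Ioo 0 t, MemLp (a' τ) p volume := by
      rintro a' (rfl | rfl | rfl) τ hτ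
      · exact memLp_slice_of_bound hum (huw' τ hτ)
      · exact memLp_slice_of_bound hKm (hKw' τ hτ)
      · exact memLp_slice_of_bound hdm (hdw' τ hτ)
    have hi : ∀ x : ℝ³, ∀ a' b' : ℝ → ℝ³ → ℝ³, (a' = u ∨ a' = uK ∨ a' = u - uK) →
        (b' = u ∨ b' = uK ∨ b' = u - uK) →
        ∀ τ ∈ Ioo 0 t, Integrable (fun y => oseenKernel (t - τ) (x - y) (a' τ y) (b' τ y)) volume :=
      fun x a' b' ha' hb' τ hτ => LpOseen.integrable_oseenSlice hp₃ (sub_pos.2 hτ.2)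
        (hmem a' ha' τ hτ) (hmem b' hb' τ hτ) x
    -- the a.e. identity `d t = -(B(u,d)(t) + B(d,uK)(t))`
    have hdt : d t =ᵐ[volume] fun x => -(kochTataruBilinear u d t x + kochTataruBilinear d uK t x) := by
      filter_upwards [hident t ht, A1, A2, A3, A4] with x hx h1 h2 h3 h4
      have hK : uK t x = heatTest 1 (u 0) t x - kochTataruBilinear uK uK t x := hfix t ht x
      have hsub := kochTataruBilinear_sub_eq (u := u) (v := uK) (hi x) h1 h2 h3 h4
      rw [hdslice, Pi.sub_apply, hx, hK]
      calc heatTest 1 (u 0) t x - kochTataruBilinear u u t x -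
            (heatTest 1 (u 0) t x - kochTataruBilinear uK uK t x)
          = -(kochTataruBilinear u u t x - kochTataruBilinear uK uK t x) := by abel
        _ = -(kochTataruBilinear u d t x + kochTataruBilinear d uK t x) := by rw [hsub]
    -- Kato's estimate for the two terms
    have hB1 := (HB hum hdm hMT hN ht0 huw' hdw').2
    have hB2 := (HB hdm hKm hN h2a ht0 hdw' hKw').2
    have hm1 := (HB hum hdm hMT hN ht0 huw' hdw').1
    have hm2 := (HB hdm hKm hN h2a ht0 hdw' hKw').1
    rw [eLpNorm_congr_ae hdt,
      show (fun x => -(kochTataruBilinear u d t x + kochTataruBilinear d uK t x)) =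
        -(kochTataruBilinear u d t + kochTataruBilinear d uK t) from rfl, eLpNorm_neg]
    calc eLpNorm (kochTataruBilinear u d t + kochTataruBilinear d uK t) p volume
        ≤ eLpNorm (kochTataruBilinear u d t) p volume + eLpNorm (kochTataruBilinear d uK t) p volume :=
          eLpNorm_add_le hm1.1 hm2.1 h1p
      _ ≤ ENNReal.ofReal (cB * ((M : ℝ) * T₁ ^ w) * N * t ^ (-w)) +
            ENNReal.ofReal (cB * N * (2 * a) * t ^ (-w)) := add_le_add hB1 hB2
      _ = ENNReal.ofReal (cB * ((M : ℝ) + 2 * ((M : ℝ) + 1)) * T₁ ^ w * N * t ^ (-w)) := by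
          rw [← ENNReal.ofReal_add (by positivity) (by positivity), ha]
          congr 1
          ring
      _ ≤ ENNReal.ofReal ((1 / 2 * N) * t ^ (-w)) := by
          refine ENNReal.ofReal_le_ofReal ?_
          have htw : 0 ≤ t ^ (-w) := Real.rpow_nonneg ht0.le _
          have h1 : cB * ((M : ℝ) + 2 * ((M : ℝ) + 1)) * T₁ ^ w ≤ 1 / 2 :=
            (mul_le_mul_of_nonneg_left hT₁w (by positivity)).trans hBε
          calc cB * ((M : ℝ) + 2 * ((M : ℝ) + 1)) * T₁ ^ w * N * t ^ (-w)
              = (cB * ((M : ℝ) + 2 * ((M : ℝ) + 1)) * T₁ ^ w) * (N * t ^ (-w)) := by ring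
            _ ≤ (1 / 2) * (N * t ^ (-w)) :=
                mul_le_mul_of_nonneg_right h1 (mul_nonneg hN htw)
            _ = (1 / 2 * N) * t ^ (-w) := by ring
  -- the initial bound and the iteration
  have hbase : ∀ τ ∈ Ioo 0 T₁, eLpNorm (d τ) p volume ≤ ENNReal.ofReal (Kw * τ ^ (-w)) := by
    intro τ hτ
    have hτw : 0 ≤ τ ^ (-w) := Real.rpow_nonneg hτ.1.le _
    rw [hdslice]
    calc eLpNorm (u τ - uK τ) p volume ≤ eLpNorm (u τ) p volume + eLpNorm (uK τ) p volume :=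
          eLpNorm_sub_le (measurable_slice hum τ).aestronglyMeasurable
            (measurable_slice hKm τ).aestronglyMeasurable h1p
      _ ≤ ENNReal.ofReal ((M : ℝ) * T₁ ^ w * τ ^ (-w)) + ENNReal.ofReal (2 * a * τ ^ (-w)) :=
          add_le_add (huw τ hτ) (hKw τ hτ)
      _ = ENNReal.ofReal (Kw * τ ^ (-w)) := by
          rw [← ENNReal.ofReal_add (by positivity) (by positivity), hKwdef]
          congr 1; ring
  have hiter : ∀ k : ℕ, ∀ τ ∈ Ioo 0 T₁,
      eLpNorm (d τ) p volume ≤ ENNReal.ofReal (((1 / 2 : ℝ) ^ k * Kw) * τ ^ (-w)) := by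
    intro k
    induction k with
    | zero => intro τ hτ; simpa using hbase τ hτ
    | succ k ih =>
      intro τ hτ
      have h := step (N := (1 / 2 : ℝ) ^ k * Kw) (by positivity) ih τ hτ
      have e : 1 / 2 * ((1 / 2 : ℝ) ^ k * Kw) = (1 / 2 : ℝ) ^ (k + 1) * Kw := by rw [pow_succ]; ring
      rwa [e] at h
  -- ### conclusion
  refine ⟨uK, hKm, fun t ht x => ?_, fun t ht => ?_⟩
  · have htm : 0 ≤ t ^ (-(1 / 2 : ℝ)) := Real.rpow_nonneg ht.1.le _
    calc ‖uK t x‖ ≤ 2 * (a + b) * t ^ (-(1 / 2 : ℝ)) := hKi t ht x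
      _ = 2 * (((M : ℝ) + 1) + c₄ * (M : ℝ)) * T₁ ^ w * t ^ (-(1 / 2 : ℝ)) := by rw [ha, hb]; ring
      _ ≤ 2 * (((M : ℝ) + 1) + c₄ * (M : ℝ)) * κ ^ w * t ^ (-(1 / 2 : ℝ)) := by
          gcongr
      _ = Cb * t ^ (-(1 / 2 : ℝ)) := by rw [hCb]
  have hzero : eLpNorm (d t) p volume = 0 := by
    refine le_antisymm ?_ bot_le
    have hlim : Tendsto (fun k : ℕ => ENNReal.ofReal (((1 / 2 : ℝ) ^ k * Kw) * t ^ (-w))) atTop (𝓝 0) := by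
      have h1 : Tendsto (fun k : ℕ => ((1 / 2 : ℝ) ^ k * Kw) * t ^ (-w)) atTop (𝓝 (0 * Kw * t ^ (-w))) :=
        ((tendsto_pow_atTop_nhds_zero_of_lt_one (by norm_num) (by norm_num)).mul_const Kw).mul_const _
      rw [zero_mul, zero_mul] at h1
      have h2 := (ENNReal.continuous_ofReal.tendsto 0).comp h1
      rwa [ENNReal.ofReal_zero] at h2
    exact ge_of_tendsto' hlim fun k => hiter k t ht
  have hae : d t =ᵐ[volume] 0 := (eLpNorm_eq_zero_iff (measurable_slice hdm t).aestronglyMeasurable hp0).1 hzero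
  filter_upwards [hae] with x hx
  have hx' : u t x - uK t x = 0 := hx
  exact sub_eq_zero.1 hx'

/-- **Comparison with Kato's solution** (Kato 1984, Thm. 1 and §2; the qualitative form of
`exists_kato_time`). Let `3 < p < ∞` and let `u` be jointly measurable on `(0, T) × ℝ³` with a
strongly measurable datum `u(0) ∈ L^p` weakly divergence free, `‖u(τ)‖_{L^p} ≤ M`, weakly
divergence-free slices and the duality identity from the datum at every `t ∈ (0, T)` (`ν = 1`).
Then on some `(0, T₁)`, `T₁ ≤ T`, `u(t)` agrees a.e., at every time, with Kato's solution `u_K`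
from `u(0)` — a jointly measurable field with `|u_K(t, x)| ≤ C t^{-1/2}`. [cite: Kato1984, Thm. 1 and §2] -/
theorem exists_kato_representative (hp₃ : 3 < p) (hp : p < ∞) (hum : Measurable (uncurry u))
    (hu0 : StronglyMeasurable (u 0)) (hu0p : MemLp (u 0) p volume) (hdiv0 : IsWeaklyDivFree (u 0))
    (hT : 0 < T) (huM : ∀ τ ∈ Ioo 0 T, eLpNorm (u τ) p volume ≤ M)
    (hdiv : ∀ t ∈ Ioo 0 T, IsWeaklyDivFree (u t))
    (hmild : ∀ t ∈ Ioo 0 T, IsMildNSSolutionFrom 1 0 (u 0) u t) :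
    ∃ T₁ : ℝ, 0 < T₁ ∧ T₁ ≤ T ∧ ∃ uK : ℝ → ℝ³ → ℝ³, Measurable (uncurry uK) ∧
      (∃ Cb : ℝ, ∀ t ∈ Ioo 0 T₁, ∀ x, ‖uK t x‖ ≤ Cb * t ^ (-(1 / 2 : ℝ))) ∧
      ∀ t ∈ Ioo 0 T₁, u t =ᵐ[volume] uK t := by
  set M' : ℝ≥0 := max M (eLpNorm (u 0) p volume).toNNReal with hM'
  have hu0M : eLpNorm (u 0) p volume ≤ M' := by
    rw [← ENNReal.coe_toNNReal hu0p.2.ne, hM']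
    exact_mod_cast le_max_right _ _
  have huM' : ∀ τ ∈ Ioo 0 T, eLpNorm (u τ) p volume ≤ M' := fun τ hτ =>
    (huM τ hτ).trans (by rw [hM']; exact_mod_cast le_max_left _ _)
  obtain ⟨κ, hκ, Cb, -, H⟩ := exists_kato_time hp₃ hp M'
  obtain ⟨uK, hKm, hKb, hae⟩ := H hum hu0 hu0p hu0M hdiv0 hT huM' hdiv hmild
  exact ⟨min T κ, lt_min hT hκ, min_le_left _ _, uK, hKm, ⟨Cb, hKb⟩, hae⟩
end Kato

/-! ### Smoothing: a classical representative after every positive time -/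

section Classical

variable {p : ℝ≥0∞} {u : ℝ → ℝ³ → ℝ³} {S : ℝ} {M : ℝ≥0}

/-- **Time translation of a classical solution on an open window** (local copy of the tree's
`IsClassicalNSSolutionOn.translate_back_Ioo`, to keep the import closure small). [folklore] -/
theorem isClassicalNSSolutionOn_translate_back {T' s ν : ℝ} {v : ℝ → ℝ³ → ℝ³} {π : ℝ → ℝ³ → ℝ}
    (h : IsClassicalNSSolutionOn (Ioo 0 T') ν 0 v π) :
    IsClassicalNSSolutionOn (Ioo s (s + T')) ν 0 (fun t => v (t - s)) (fun t => π (t - s)) := by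
  have h1 := h.comp_add_right (-s)
  have hset : (fun t : ℝ => t + -s) ⁻¹' Ioo 0 T' = Ioo s (s + T') := by
    ext t
    simp only [mem_preimage, mem_Ioo]
    constructor
    · rintro ⟨h1, h2⟩; exact ⟨by linarith, by linarith⟩
    · rintro ⟨h1, h2⟩; exact ⟨by linarith, by linarith⟩
  rw [hset] at h1
  have hf : (fun t : ℝ => (0 : ℝ → ℝ³ → ℝ³) (t + -s)) = 0 := by funext t; rfl
  have hu' : (fun t : ℝ => v (t + -s)) = fun t => v (t - s) := by funext t; rw [← sub_eq_add_neg]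
  have hp' : (fun t : ℝ => π (t + -s)) = fun t => π (t - s) := by funext t; rw [← sub_eq_add_neg]
  rw [hf, hu', hp'] at h1
  exact h1

/-- **Restart of the hypotheses at a positive time** `s₀ ∈ (0, S)`: the translate
`ũ(τ) = u(τ + s₀)` on `(0, S − s₀)` is jointly measurable with datum `u(s₀)`, inherits the `L^p`
bound and the weak divergence-freeness, and satisfies the duality identity from its datum
(`IsMildNSSolutionFrom 1 0 (ũ 0) ũ t`) at every `t ∈ (0, S − s₀)`. [cite: FabesJonesRiviere1972, Thm. 2.1] -/
theorem restart_hypotheses (hum : StronglyMeasurable (uncurry u))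
    (huM : ∀ τ ∈ Ioo 0 S, eLpNorm (u τ) p volume ≤ M)
    (hdiv : ∀ τ ∈ Ioo 0 S, IsWeaklyDivFree (u τ))
    (hmild : ∀ ⦃s t : ℝ⦄, 0 < s → s ≤ t → t < S → IsMildNSSolutionBetween 1 0 u s t)
    {s₀ : ℝ} (hs₀ : s₀ ∈ Ioo 0 S) :
    Measurable (uncurry fun τ => u (τ + s₀)) ∧ StronglyMeasurable ((fun τ => u (τ + s₀)) 0) ∧
      MemLp ((fun τ => u (τ + s₀)) 0) p volume ∧ IsWeaklyDivFree ((fun τ => u (τ + s₀)) 0) ∧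
      (∀ τ ∈ Ioo 0 (S - s₀), eLpNorm ((fun τ => u (τ + s₀)) τ) p volume ≤ M) ∧
      (∀ t ∈ Ioo 0 (S - s₀), IsWeaklyDivFree ((fun τ => u (τ + s₀)) t)) ∧
      ∀ t ∈ Ioo 0 (S - s₀), IsMildNSSolutionFrom 1 0 ((fun τ => u (τ + s₀)) 0) (fun τ => u (τ + s₀)) t := by
  have hmeas : Measurable (uncurry fun τ => u (τ + s₀)) :=
    hum.measurable.comp ((measurable_fst.add_const s₀).prodMk measurable_snd)
  have h0 : (0 : ℝ) + s₀ = s₀ := zero_add s₀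
  have hslice0 : StronglyMeasurable ((fun τ => u (τ + s₀)) 0) := by
    show StronglyMeasurable (u (0 + s₀))
    exact hum.comp_measurable (measurable_const.prodMk measurable_id)
  refine ⟨hmeas, hslice0, ?_, ?_, fun τ hτ => huM _ ⟨by linarith [hτ.1, hs₀.1], by linarith [hτ.2]⟩,
    fun t ht => hdiv _ ⟨by linarith [ht.1, hs₀.1], by linarith [ht.2]⟩, fun t ht => ?_⟩
  · show MemLp (u (0 + s₀)) p volume
    rw [h0]
    exact ⟨(hum.comp_measurable (measurable_const.prodMk measurable_id)).aestronglyMeasurable,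
      lt_of_le_of_lt (huM s₀ hs₀) ENNReal.coe_lt_top⟩
  · show IsWeaklyDivFree (u (0 + s₀))
    rw [h0]; exact hdiv s₀ hs₀
  · have hb' : IsMildNSSolutionBetween 1 0 u s₀ (t + s₀) :=
      hmild hs₀.1 (by linarith [ht.1]) (by linarith [ht.2])
    have hb : IsMildNSSolutionBetween 1 0 u (0 + s₀) (t + s₀) := by rwa [h0]
    have h2 : IsMildNSSolutionBetween 1 0 (fun τ => u (τ + s₀)) 0 t :=
      IsMildNSSolutionBetween.comp_add_right_zero hb
    exact isMildNSSolutionFrom_self_iff.2 h2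

set_option maxHeartbeats 1600000 in
/-- **The smooth window after a restart** (KNSS 2009, Prop. 4.1, applied to Kato's representative).
Let `3 < p < ∞` and let `u` be jointly (strongly) measurable on `(0, S) × ℝ³` with
`‖u(τ)‖_{L^p} ≤ M`, weakly divergence-free slices and the two-time duality identity between all
`0 < s ≤ t < S` (`ν = 1`, no force). Suppose that after the restart at `s₀ ∈ (0, S)` the slices
`u(t + s₀)`, `t ∈ (0, T₁)`, `s₀ + T₁ ≤ S`, agree a.e. with a jointly measurable field `u_K` with
`|u_K(t, x)| ≤ C_b t^{-1/2}` (Kato's representative, `exists_kato_time`). Then on the window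
`(0, T₁/2)` after the time `s₀ + T₁/2` there is a jointly smooth `W` with
`W(t) = u(t + s₀ + T₁/2)` a.e. for every `t`, `|W| ≤ |C_b| (T₁/2)^{-1/2}`, all the weighted derivative
bounds `t^{k/2+l} |∇ᵏ∂ₜˡ W| ≤ C(k,l)` of KNSS's Prop. 4.1, and which is a mild solution in the
duality form from the datum `u(s₀ + T₁/2)`. Proof: the integral equation from the slice
`u(s₀ + T₁/2)` (`ae_eq_heatTest_sub_kochTataruBilinear`), with `u_K(· + T₁/2)` — bounded by
`|C_b| (T₁/2)^{-1/2}` — inside the Duhamel term; `knss2009_smoothing_holds`; transfer of the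
duality identities along a.e. equality. [cite: KochNadirashviliSereginSverak2009, Prop. 4.1; Kato1984, Thm. 1] -/
theorem exists_smooth_window (hp₃ : 3 < p) (hp : p < ∞)
    (hum : StronglyMeasurable (uncurry u))
    (huM : ∀ τ ∈ Ioo 0 S, eLpNorm (u τ) p volume ≤ M)
    (hdiv : ∀ τ ∈ Ioo 0 S, IsWeaklyDivFree (u τ))
    (hmild : ∀ ⦃s t : ℝ⦄, 0 < s → s ≤ t → t < S → IsMildNSSolutionBetween 1 0 u s t)
    {s₀ T₁ : ℝ} (hs₀ : s₀ ∈ Ioo 0 S) (hT₁0 : 0 < T₁) (hT₁ : s₀ + T₁ ≤ S)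
    {uK : ℝ → ℝ³ → ℝ³} (hKm : Measurable (uncurry uK)) {Cb : ℝ}
    (hKb : ∀ t ∈ Ioo 0 T₁, ∀ x, ‖uK t x‖ ≤ Cb * t ^ (-(1 / 2 : ℝ)))
    (hae₁ : ∀ t ∈ Ioo 0 T₁, u (t + s₀) =ᵐ[volume] uK t) :
    ∃ W : ℝ → ℝ³ → ℝ³, IsSmoothSpaceTimeOn (Ioo 0 (T₁ / 2)) W ∧
      (∀ t ∈ Ioo 0 (T₁ / 2), W t =ᵐ[volume] u (t + (s₀ + T₁ / 2))) ∧
      (∀ t ∈ Ioo 0 (T₁ / 2), ∀ x, ‖W t x‖ ≤ |Cb| * (T₁ / 2) ^ (-(1 / 2 : ℝ))) ∧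
      (∀ k l : ℕ, ∃ C : ℝ, ∀ t ∈ Ioo 0 (T₁ / 2), ∀ x,
        (t - 0) ^ ((k : ℝ) / 2 + l) *
          ‖iteratedFDeriv ℝ k (fun y => iteratedDeriv l (fun τ => W τ y) t) x‖ ≤ C) ∧
      IsMildNSSolutionOn (Ioo 0 (T₁ / 2)) 1 0 (u (0 + (s₀ + T₁ / 2))) W := by
  have hp1 : 1 < p := lt_trans (by norm_num) hp₃
  -- ### restart at `δ = T₁ / 2` after `s₀`
  set δ : ℝ := T₁ / 2 with hδ
  have hδ0 : 0 < δ := by positivity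
  have hδT₁ : δ < T₁ := by rw [hδ]; linarith
  have hs₁ : s₀ + δ ∈ Ioo 0 S := ⟨by linarith [hs₀.1], by linarith [hs₀.2]⟩
  obtain ⟨hûm, hû0, hû0p, hdivû0, hûM, hdivû, hmildû⟩ := restart_hypotheses hum huM hdiv hmild hs₁
  set û : ℝ → ℝ³ → ℝ³ := fun τ => u (τ + (s₀ + δ)) with hû
  -- the bounded representative `ū = u_K(· + δ)`
  set ū : ℝ → ℝ³ → ℝ³ := fun τ => uK (τ + δ) with hū
  have hūm : Measurable (uncurry ū) := hKm.comp ((measurable_fst.add_const δ).prodMk measurable_snd)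
  set Mb : ℝ := |Cb| * δ ^ (-(1 / 2 : ℝ)) with hMb
  have hMb0 : 0 ≤ Mb := by positivity
  have hūb : ∀ τ, 0 ≤ τ → τ + δ < T₁ → ∀ x, ‖ū τ x‖ ≤ Mb := by
    intro τ hτ0 hτ x
    have hτδ : 0 < τ + δ := by linarith
    calc ‖ū τ x‖ = ‖uK (τ + δ) x‖ := rfl
      _ ≤ Cb * (τ + δ) ^ (-(1 / 2 : ℝ)) := hKb _ ⟨hτδ, hτ⟩ x
      _ ≤ |Cb| * (τ + δ) ^ (-(1 / 2 : ℝ)) :=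
          mul_le_mul_of_nonneg_right (le_abs_self _) (Real.rpow_nonneg hτδ.le _)
      _ ≤ |Cb| * δ ^ (-(1 / 2 : ℝ)) := by
          refine mul_le_mul_of_nonneg_left ?_ (abs_nonneg _)
          exact Real.rpow_le_rpow_of_nonpos hδ0 (by linarith) (by norm_num)
  have hae₂ : ∀ τ ∈ Ico 0 (T₁ - δ), û τ =ᵐ[volume] ū τ := by
    intro τ hτ
    have e : û τ = u ((τ + δ) + s₀) := by
      simp only [hû]; congr 1; ring
    rw [e]
    exact hae₁ (τ + δ) ⟨by linarith [hτ.1], by linarith [hτ.2]⟩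
  -- ### the integral equation from the slice `û 0`, with `ū` inside
  have hident : ∀ σ ∈ Ioo 0 δ, ū σ =ᵐ[volume] fun x =>
      UnboundedOperators.heatExtension (û 0) (1 * (σ - 0)) x - oseenDuhamel 1 0 ū ū σ x := by
    intro σ hσ
    have hσ' : σ ∈ Ioo 0 (S - (s₀ + δ)) := ⟨hσ.1, by linarith [hσ.2]⟩
    have h1 := ae_eq_heatTest_sub_kochTataruBilinear hp₃ hp hûm hû0p hdivû0 hûM hσ' (hdivû σ hσ')
      (hmildû σ hσ')
    have h2 : û σ =ᵐ[volume] ū σ := hae₂ σ ⟨hσ.1.le, by linarith [hσ.2]⟩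
    have hB : ∀ x, kochTataruBilinear û û σ x = oseenDuhamel 1 0 ū ū σ x := by
      intro x
      rw [kochTataruBilinear_eq_oseenDuhamel]
      exact oseenDuhamel_congr_ae_slice (fun τ hτ => hae₂ τ ⟨hτ.1.le, by linarith [hτ.2, hσ.2]⟩)
        (fun τ hτ => hae₂ τ ⟨hτ.1.le, by linarith [hτ.2, hσ.2]⟩) x
    have hH : ∀ x, heatTest 1 (û 0) σ x = UnboundedOperators.heatExtension (û 0) (1 * (σ - 0)) x := by
      intro x
      rw [heatTest_of_pos one_pos hσ.1, sub_zero]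
    filter_upwards [h1, h2] with x hx1 hx2
    rw [← hx2, hx1, hB x, hH x]
  -- ### smoothing of the bounded solution of the integral equation
  have hâm : AEStronglyMeasurable (û 0) volume := hû0.aestronglyMeasurable
  have hâb : eLpNorm (û 0) ∞ volume ≤ ENNReal.ofReal Mb := by
    rw [eLpNorm_congr_ae (hae₂ 0 ⟨le_rfl, by linarith⟩), eLpNorm_exponent_top]
    exact eLpNormEssSup_le_of_ae_bound (Eventually.of_forall fun x => hūb 0 le_rfl (by linarith) x)
  have hūS : AEStronglyMeasurable (uncurry ū) (volume.restrict (Ioo 0 δ ×ˢ univ)) :=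
    hūm.aestronglyMeasurable
  have hūtop : ∀ t ∈ Ioo 0 δ, eLpNorm (ū t) ∞ volume ≤ ENNReal.ofReal Mb := by
    intro t ht
    rw [eLpNorm_exponent_top]
    exact eLpNormEssSup_le_of_ae_bound (Eventually.of_forall fun x =>
      hūb t ht.1.le (by linarith [ht.2]) x)
  obtain ⟨hsmooth, hWb, hder⟩ := knss2009_smoothing_holds (E := ℝ³) one_pos hδ0 hMb0 hâm hâb hūS hūtop
    hident
  set W : ℝ → ℝ³ → ℝ³ := fun t x =>
    UnboundedOperators.heatExtension (û 0) (1 * (t - 0)) x - oseenDuhamel 1 0 ū ū t x with hW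
  have hWû : ∀ t ∈ Ioo 0 δ, W t =ᵐ[volume] û t := by
    intro t ht
    have h := (hident t ht).symm
    exact h.trans (hae₂ t ⟨ht.1.le, by linarith [ht.2]⟩).symm
  -- ### the smooth representative is a mild solution in duality form
  have hmildW : IsMildNSSolutionOn (Ioo 0 δ) 1 0 (û 0) W := by
    have h : IsMildNSSolutionOn (Ioo 0 δ) 1 0 (û 0) û :=
      ⟨fun t ht => hdivû t ⟨ht.1, by linarith [ht.2]⟩,
        fun t ht => hmildû t ⟨ht.1, by linarith [ht.2]⟩⟩
    exact h.congr_ae_Ioo hWû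
  refine ⟨W, hsmooth, fun t ht => ?_, hWb, hder, hmildW⟩
  exact hWû t ht

set_option maxHeartbeats 800000 in
/-- **A classical representative after every positive time** (Kato 1984 with KNSS 2009,
Prop. 4.1, and Fabes–Jones–Rivière 1972, Thm. 2.1). Let `3 < p < ∞` and let `u` be jointly
(strongly) measurable on `(0, S) × ℝ³` with `‖u(τ)‖_{L^p} ≤ M`, weakly divergence-free slices, and
the two-time duality identity between all `0 < s ≤ t < S` (`ν = 1`, no force). Then for every
`s₀ ∈ (0, S)` there are `s₀ ≤ a < b ≤ S` and a classical solution `(W, π)` of Navier–Stokes on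
`(a, b) × ℝ³` with `W(t) = u(t)` a.e. for every `t ∈ (a, b)`. Proof: restart at `s₀`; Kato's
representative `u_K` on `(0, T₁)` (`exists_kato_representative`); the smooth window
(`exists_smooth_window`); the smooth representative is classical
(`classical_of_smooth_isMildNSSolutionOn_holds`, the datum `u(s₀ + T₁/2) ∈ L^p` being integrable
against Gaussians); translate back. [cite: Kato1984, Thm. 1; KochNadirashviliSereginSverak2009, Prop. 4.1; FabesJonesRiviere1972, Thm. 2.1] -/
theorem exists_classical_representative (hp₃ : 3 < p) (hp : p < ∞)
    (hum : StronglyMeasurable (uncurry u))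
    (huM : ∀ τ ∈ Ioo 0 S, eLpNorm (u τ) p volume ≤ M)
    (hdiv : ∀ τ ∈ Ioo 0 S, IsWeaklyDivFree (u τ))
    (hmild : ∀ ⦃s t : ℝ⦄, 0 < s → s ≤ t → t < S → IsMildNSSolutionBetween 1 0 u s t)
    {s₀ : ℝ} (hs₀ : s₀ ∈ Ioo 0 S) :
    ∃ (a b : ℝ) (W : ℝ → ℝ³ → ℝ³) (π : ℝ → ℝ³ → ℝ), s₀ ≤ a ∧ a < b ∧ b ≤ S ∧
      IsClassicalNSSolutionOn (Ioo a b) 1 0 W π ∧ ∀ t ∈ Ioo a b, W t =ᵐ[volume] u t := by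
  have hp1 : 1 < p := lt_trans (by norm_num) hp₃
  haveI hconj := holderConjugate_self hp1
  -- ### restart at `s₀` and Kato's representative on `(0, T₁)`
  have hT : 0 < S - s₀ := sub_pos.2 hs₀.2
  obtain ⟨hũm, hũ0, hũ0p, hdivũ0, hũM, hdivũ, hmildũ⟩ := restart_hypotheses hum huM hdiv hmild hs₀
  obtain ⟨T₁, hT₁0, hT₁T, uK, hKm, ⟨Cb, hKb⟩, hae₁⟩ :=
    exists_kato_representative hp₃ hp hũm hũ0 hũ0p hdivũ0 hT hũM hdivũ hmildũ
  -- ### the smooth window after `s₀ + T₁/2`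
  obtain ⟨W, hsmooth, hWu, hWb, -, hmildW⟩ := exists_smooth_window hp₃ hp hum huM hdiv hmild hs₀ hT₁0
    (by linarith) hKm hKb hae₁
  set δ : ℝ := T₁ / 2 with hδ
  have hδ0 : 0 < δ := by positivity
  have hs₁ : s₀ + δ ∈ Ioo 0 S := ⟨by linarith [hs₀.1], by linarith [hs₀.2]⟩
  -- ### the datum `u(s₀ + δ)` and the classical equations
  have h0 : (0 : ℝ) + (s₀ + δ) = s₀ + δ := zero_add _
  have hâm : AEStronglyMeasurable (u (0 + (s₀ + δ))) volume := by
    rw [h0]; exact (hum.comp_measurable (measurable_const.prodMk measurable_id)).aestronglyMeasurable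
  have hâp : MemLp (u (0 + (s₀ + δ))) p volume := by
    rw [h0]
    exact ⟨(hum.comp_measurable (measurable_const.prodMk measurable_id)).aestronglyMeasurable,
      lt_of_le_of_lt (huM _ hs₁) ENNReal.coe_lt_top⟩
  have hGauss : ∀ a : ℝ, 0 < a →
      Integrable (fun y => UnboundedOperators.heatKernel a y * ‖u (0 + (s₀ + δ)) y‖) volume := by
    intro a ha
    have hG : MemLp (UnboundedOperators.heatKernel (E := ℝ³) a) (1 - p⁻¹)⁻¹ volume :=
      UnboundedOperators.memLp_heatKernel ha (one_le_conj p)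
    have h1 : MemLp (fun y => UnboundedOperators.heatKernel a y * ‖u (0 + (s₀ + δ)) y‖) 1 volume :=
      hâp.norm.mul' hG
    exact memLp_one_iff_integrable.1 h1
  set Mb : ℝ := |Cb| * (T₁ / 2) ^ (-(1 / 2 : ℝ)) with hMb
  have hWtop : ∀ T' ∈ Ioo 0 δ, ∃ C : ℝ≥0∞, C < ⊤ ∧ ∀ t ∈ Ioo 0 T', eLpNorm (W t) ⊤ volume ≤ C := by
    intro T' hT'
    refine ⟨ENNReal.ofReal Mb, ENNReal.ofReal_lt_top, fun t ht => ?_⟩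
    rw [eLpNorm_exponent_top]
    exact eLpNormEssSup_le_of_ae_bound (Eventually.of_forall fun x => hWb t ⟨ht.1, ht.2.trans hT'.2⟩ x)
  obtain ⟨π, hclass⟩ := classical_of_smooth_isMildNSSolutionOn_holds (E := ℝ³) one_pos hδ0 hâm hGauss
    hsmooth hWtop hmildW
  -- ### translate back by `s₀ + δ`
  have hback := isClassicalNSSolutionOn_translate_back (s := s₀ + δ) hclass
  refine ⟨s₀ + δ, s₀ + δ + δ, fun t => W (t - (s₀ + δ)), fun t => π (t - (s₀ + δ)), by linarith,
    by linarith, by linarith, hback, fun t ht => ?_⟩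
  have hσ : t - (s₀ + δ) ∈ Ioo 0 (T₁ / 2) := ⟨by linarith [ht.1], by linarith [ht.2]⟩
  have h := hWu _ hσ
  have e : t - (s₀ + δ) + (s₀ + T₁ / 2) = t := by rw [hδ]; ring
  rw [e] at h
  exact h

end Classical

end LpMildKato

end Literature.Analysis.FluidPDE

end
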